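import Mathlib.Algebra.Algebra.Subalgebra.Basic
import Mathlib.Algebra.Module.LinearMap.End
import Mathlib.Algebra.Module.Submodule.LinearMap
import Mathlib.LinearAlgebra.Span.Basic
import Mathlib.Algebra.BigOperators.GroupWithZero.Action
import HarnessLib

/-!
# Jacquet–Shalika's descent lemma for Whittaker-covariant functionals (statement (2) of the proof of Prop. (3.8)), multi-letter form

Topic `Algebra/Lie`; namespace `Literature.Algebra.Lie.WhittakerDescent`. Pure algebra over a field
`F`. The setting abstracts the enveloping algebra acting (on the right, by precomposition
`μ ↦ μ ∘ X`) on linear functionals of a `𝔤𝔩₂`-type module: an `F`-algebra `A` of endomorphisms of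
a vector space `V`, a subalgebra `B ≤ A` (the image of `U(𝔟) ⊗` scalars — "`𝔍`" in Jacquet–Shalika),
and finitely many *letters* `e⁻ a` (the directions of the opposite nilradical `𝔲̄`, one per real
place / holomorphic type) with partners `e⁺ a ∈ B` such that

* (H1) `e⁻ a · b ∈ B · e⁻ a + B` for `b ∈ B` (`ad(e⁻ a)` maps `𝔟` into `𝔟 ⊕ F e⁻ a`);
* (H2) `e⁻ a · e⁺ a ∈ B` (the Casimir relation `E⁺E⁻ ≡ E⁻E⁺ ≡ 0 (mod 𝔍)`, Jacquet–Shalika (1981),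
  p. 523, available once the centre acts by scalars);
* (H3) `e⁻ a · e⁺ a' = e⁺ a' · e⁻ a` for `a ≠ a'` (letters at different places / types commute).

A functional `ℓ` is *Whittaker-covariant* if `ℓ ∘ e⁺ a = θ a · ℓ` with `θ a ≠ 0` for every letter.
Jacquet–Shalika's statement (2) (proof of Prop. (3.8), p. 523: "Suppose there is a subspace `𝒲` of
`𝒱` stable under `𝔍` such that `λ` is in `𝔏(Ū)𝒲 + 𝒲`. Then `λ` is in `𝒲`."), proved there for one
letter (`r = 2`, `F = ℝ`), holds for finitely many commuting letters:

* `comp_mem_of_rep` — **stability**: if `W ≤ V*` is right `B`-stable then so is the class of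
  functionals of the form `w + Σ_a μ_a ∘ e⁻ a` (`w, μ_a ∈ W`) — by (H1);
* `mem_of_rep_of_covariant` — **descent**: a Whittaker-covariant `ℓ = w + Σ_{a ∈ S} μ_a ∘ e⁻ a` with
  `w, μ_a ∈ W`, `W` right `B`-stable, lies in `W` — by induction on `S`: composing with `e⁺ a₀`,
  `θ_{a₀} ℓ = ℓ ∘ e⁺_{a₀} = (w ∘ e⁺ + μ_{a₀} ∘ (e⁻e⁺)) + Σ_{a ≠ a₀} (μ_a ∘ e⁺_{a₀}) ∘ e⁻ a` is a
  representation with one letter fewer ((H2), (H3), `e⁺ ∈ B`).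

Iterating the descent over the filtration by `e⁻`-degree (each step `B`-stable by the first lemma)
brings a functional of finite `e⁻`-degree down to degree `0`, i.e. to a `𝔟`-continuous one: this is
the algebraic core of the automatic continuity `λ ∈ ℋ_G^{-∞} ⇒ λ ∈ ℋ_P^{-∞}` for `GL₂` over a
product of archimedean fields, on the route to the named fact
`Literature.NumberTheory.Automorphic.JacquetShalika1981_archKirillovNorm_le`.

## References

* H. Jacquet, J. A. Shalika, *On Euler products and the classification of automorphic
  representations I*, Amer. J. Math. 103 (1981), 499–558, §3, proof of Prop. (3.8), statement (2)
  and the case `r = 2`, p. 523 [JacquetShalikaAJM1981].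
-/

namespace Literature.Algebra.Lie.WhittakerDescent

open scoped BigOperators

variable {F : Type*} [Field F] {V : Type*} [AddCommGroup V] [Module F V]

/-- `(Σ_i f_i) ∘ g = Σ_i (f_i ∘ g)` for linear maps. [folklore] -/
theorem sum_comp {ι : Type*} (s : Finset ι) (f : ι → V →ₗ[F] F) (g : Module.End F V) :
    (∑ i ∈ s, f i).comp g = ∑ i ∈ s, (f i).comp g := by
  refine LinearMap.ext fun x => ?_
  rw [LinearMap.comp_apply, LinearMap.sum_apply, LinearMap.sum_apply]
  rfl

/-- **Stability (Jacquet–Shalika's "𝒲 stable under 𝔍", one degree up).** Let `W ≤ V*` be stable under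
right composition with the subalgebra `B`, and suppose (H1): for every letter `a` and `b ∈ B` there are
`b₁, b₂ ∈ B` with `e⁻ a * b = b₁ * e⁻ a + b₂`. Then the functionals of the form
`w + Σ_{a ∈ S} μ_a ∘ e⁻ a` (`w, μ_a ∈ W`) are again stable under right composition with `B`:
`(μ ∘ e⁻ a) ∘ b = (μ ∘ b₁) ∘ e⁻ a + μ ∘ b₂`. [cite: JacquetShalikaAJM1981, §3, proof of Prop. (3.8), statement (2), p. 523] -/
theorem comp_mem_of_rep {ι : Type*} [DecidableEq ι] (S : Finset ι) (em : ι → Module.End F V)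
    (B : Subalgebra F (Module.End F V)) (W : Submodule F (V →ₗ[F] F))
    (hW : ∀ b ∈ B, ∀ μ ∈ W, μ.comp b ∈ W)
    (h1 : ∀ a ∈ S, ∀ b ∈ B, ∃ b₁ ∈ B, ∃ b₂ ∈ B, em a * b = b₁ * em a + b₂)
    {ν : V →ₗ[F] F} (hν : ∃ w ∈ W, ∃ μ : ι → V →ₗ[F] F, (∀ a ∈ S, μ a ∈ W) ∧ ν = w + ∑ a ∈ S, (μ a).comp (em a))
    {b : Module.End F V} (hb : b ∈ B) :
    ∃ w ∈ W, ∃ μ : ι → V →ₗ[F] F, (∀ a ∈ S, μ a ∈ W) ∧ ν.comp b = w + ∑ a ∈ S, (μ a).comp (em a) := by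
  obtain ⟨w, hw, μ, hμ, rfl⟩ := hν
  -- choose `b₁ a, b₂ a` for `a ∈ S`
  have hch : ∀ a, ∃ b₁ b₂ : Module.End F V, a ∈ S → b₁ ∈ B ∧ b₂ ∈ B ∧ em a * b = b₁ * em a + b₂ := by
    intro a
    by_cases ha : a ∈ S
    · obtain ⟨b₁, hb₁, b₂, hb₂, h⟩ := h1 a ha b hb
      exact ⟨b₁, b₂, fun _ => ⟨hb₁, hb₂, h⟩⟩
    · exact ⟨0, 0, fun h => absurd h ha⟩
  choose b₁ b₂ hb₁₂ using hch
  refine ⟨w.comp b + ∑ a ∈ S, (μ a).comp (b₂ a), ?_, fun a => (μ a).comp (b₁ a), fun a ha => ?_, ?_⟩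
  · exact Submodule.add_mem _ (hW b hb w hw)
      (Submodule.sum_mem _ fun a ha => hW _ (hb₁₂ a ha).2.1 _ (hμ a ha))
  · exact hW _ (hb₁₂ a ha).1 _ (hμ a ha)
  · rw [LinearMap.add_comp, sum_comp, add_assoc, ← Finset.sum_add_distrib]
    congr 1
    refine Finset.sum_congr rfl fun a ha => ?_
    rw [LinearMap.comp_assoc, ← Module.End.mul_eq_comp, (hb₁₂ a ha).2.2, Module.End.mul_eq_comp,
      LinearMap.comp_add, ← LinearMap.comp_assoc, add_comm]

/-- **Descent (Jacquet–Shalika (1981), proof of Prop. (3.8), statement (2), multi-letter form).** Let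
`W ≤ V*` be right `B`-stable, let the letters satisfy (H2) `e⁻ a * e⁺ a ∈ B`, (H3)
`e⁻ a * e⁺ a' = e⁺ a' * e⁻ a` for `a ≠ a'`, with `e⁺ a ∈ B`, and let `ℓ` be Whittaker-covariant:
`ℓ ∘ e⁺ a = θ a • ℓ` with `θ a ≠ 0`. If `ℓ = w + Σ_{a ∈ S} μ_a ∘ e⁻ a` with `w, μ_a ∈ W`, then
`ℓ ∈ W`. (Composing with `e⁺ a₀`, `a₀ ∈ S`:
`θ_{a₀} ℓ = (w ∘ e⁺_{a₀} + μ_{a₀} ∘ (e⁻_{a₀} e⁺_{a₀})) + Σ_{a ∈ S ∖ a₀} (μ_a ∘ e⁺_{a₀}) ∘ e⁻ a`, a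
representation of `ℓ` with one letter fewer; induct on `S`.)
[cite: JacquetShalikaAJM1981, §3, proof of Prop. (3.8), statement (2), p. 523] -/
theorem mem_of_rep_of_covariant {ι : Type*} [DecidableEq ι] (em ep : ι → Module.End F V) (θ : ι → F)
    (B : Subalgebra F (Module.End F V)) (W : Submodule F (V →ₗ[F] F))
    (hW : ∀ b ∈ B, ∀ μ ∈ W, μ.comp b ∈ W)
    (hep : ∀ a, ep a ∈ B) (h2 : ∀ a, em a * ep a ∈ B) (h3 : ∀ a a', a ≠ a' → em a * ep a' = ep a' * em a)
    (hθ : ∀ a, θ a ≠ 0) {ℓ : V →ₗ[F] F} (hcov : ∀ a, ℓ.comp (ep a) = θ a • ℓ) (S : Finset ι)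
    (hrep : ∃ w ∈ W, ∃ μ : ι → V →ₗ[F] F, (∀ a ∈ S, μ a ∈ W) ∧ ℓ = w + ∑ a ∈ S, (μ a).comp (em a)) :
    ℓ ∈ W := by
  induction S using Finset.induction_on with
  | empty =>
    obtain ⟨w, hw, μ, _, h⟩ := hrep
    rw [Finset.sum_empty, add_zero] at h
    rw [h]; exact hw
  | insert a₀ S ha₀ ih =>
    obtain ⟨w, hw, μ, hμ, h⟩ := hrep
    apply ih
    -- compose the representation with `e⁺ a₀`
    have hcomp : ℓ.comp (ep a₀) = w.comp (ep a₀) + ((μ a₀).comp (em a₀ * ep a₀) +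
        ∑ a ∈ S, ((μ a).comp (ep a₀)).comp (em a)) := by
      conv_lhs => rw [h]
      rw [LinearMap.add_comp, sum_comp, Finset.sum_insert ha₀]
      congr 1
      congr 1
      refine Finset.sum_congr rfl fun a ha => ?_
      have hne : a ≠ a₀ := fun hh => ha₀ (hh ▸ ha)
      change μ a ∘ₗ (em a * ep a₀) = μ a ∘ₗ (ep a₀ * em a)
      rw [h3 a a₀ hne]
    rw [hcov a₀] at hcomp
    -- divide by `θ a₀`
    have hℓ : ℓ = (θ a₀)⁻¹ • (w.comp (ep a₀) + (μ a₀).comp (em a₀ * ep a₀)) +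
        ∑ a ∈ S, ((θ a₀)⁻¹ • (μ a).comp (ep a₀)).comp (em a) := by
      have h' := congrArg (fun ν : V →ₗ[F] F => (θ a₀)⁻¹ • ν) hcomp
      simp only [smul_smul, inv_mul_cancel₀ (hθ a₀), one_smul] at h'
      rw [h']
      simp only [smul_add, Finset.smul_sum, LinearMap.smul_comp, add_assoc]
    refine ⟨(θ a₀)⁻¹ • (w.comp (ep a₀) + (μ a₀).comp (em a₀ * ep a₀)), ?_,
      fun a => (θ a₀)⁻¹ • (μ a).comp (ep a₀), fun a ha => ?_, hℓ⟩
    · exact Submodule.smul_mem _ _ (Submodule.add_mem _ (hW _ (hep a₀) _ hw)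
        (hW _ (h2 a₀) _ (hμ a₀ (Finset.mem_insert_self a₀ S))))
    · exact Submodule.smul_mem _ _ (hW _ (hep a₀) _ (hμ a (Finset.mem_insert_of_mem ha)))

/-- **Iterated descent along the `e⁻`-degree filtration.** Let `W : ℕ → Submodule F V*` satisfy: `W 0`
is right `B`-stable, and `W (J+1)` consists exactly of the functionals `w + Σ_a μ_a ∘ e⁻ a` with
`w, μ_a ∈ W J` (sum over all letters of the finite index type). Under (H1)–(H3), `e⁺ a ∈ B`, `θ a ≠ 0`,
every Whittaker-covariant `ℓ ∈ W J` lies in `W 0`: each `W J` is `B`-stable (`comp_mem_of_rep`) and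
`mem_of_rep_of_covariant` descends one step at a time. This is how statement (2) of Jacquet–Shalika is
used: "it would suffice to show that `λ ∈ ℋ^{-n}` implies `λ ∈ ℋ^{-n+1}`" (p. 523).
[cite: JacquetShalikaAJM1981, §3, proof of Prop. (3.8), p. 523] -/
theorem mem_zero_of_mem_of_covariant {ι : Type*} [Fintype ι] [DecidableEq ι] (em ep : ι → Module.End F V)
    (θ : ι → F) (B : Subalgebra F (Module.End F V)) (W : ℕ → Submodule F (V →ₗ[F] F))
    (hW0 : ∀ b ∈ B, ∀ μ ∈ W 0, μ.comp b ∈ W 0)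
    (hWsucc : ∀ J (ν : V →ₗ[F] F), ν ∈ W (J + 1) ↔
      ∃ w ∈ W J, ∃ μ : ι → V →ₗ[F] F, (∀ a, μ a ∈ W J) ∧ ν = w + ∑ a, (μ a).comp (em a))
    (h1 : ∀ a, ∀ b ∈ B, ∃ b₁ ∈ B, ∃ b₂ ∈ B, em a * b = b₁ * em a + b₂)
    (hep : ∀ a, ep a ∈ B) (h2 : ∀ a, em a * ep a ∈ B) (h3 : ∀ a a', a ≠ a' → em a * ep a' = ep a' * em a)
    (hθ : ∀ a, θ a ≠ 0) {ℓ : V →ₗ[F] F} (hcov : ∀ a, ℓ.comp (ep a) = θ a • ℓ) {J : ℕ} (hℓ : ℓ ∈ W J) :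
    ℓ ∈ W 0 := by
  -- every `W J` is `B`-stable
  have hstab : ∀ J, ∀ b ∈ B, ∀ μ ∈ W J, μ.comp b ∈ W J := by
    intro J
    induction J with
    | zero => exact hW0
    | succ J ihJ =>
      intro b hb ν hν
      obtain ⟨w, hw, μ, hμ, h⟩ := (hWsucc J ν).1 hν
      obtain ⟨w', hw', μ', hμ', h'⟩ := comp_mem_of_rep (Finset.univ : Finset ι) em B (W J) ihJ
        (fun a _ b hb => h1 a b hb) ⟨w, hw, μ, fun a _ => hμ a, h⟩ hb
      exact (hWsucc J _).2 ⟨w', hw', μ', fun a => hμ' a (Finset.mem_univ a), h'⟩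
  -- descend
  induction J with
  | zero => exact hℓ
  | succ J ihJ =>
    apply ihJ
    obtain ⟨w, hw, μ, hμ, h⟩ := (hWsucc J ℓ).1 hℓ
    exact mem_of_rep_of_covariant em ep θ B (W J) (hstab J) hep h2 h3 hθ hcov Finset.univ
      ⟨w, hw, μ, fun a _ => hμ a, h⟩

end Literature.Algebra.Lie.WhittakerDescent
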